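import Summits.BirchSwinnertonDyer.BirchSwinnertonDyer.Theorems.PrintCf2RamifiedOffTYZQFormKeyLemma
import HarnessLib

/-!
# Route `PrintCf2`, crux stmt-BirchSwinnertonDyer-20509 `RamifiedOffTYZOfFacts` — the Q-form identity (★): Ψ = 0 AND THE ABSTRACT (★a) (F3b)
# (cell `bsd-print-cf2`, LEAD of 20509 g6, line `offtyz-v7`, cycle 7; kernel helpers `--supports stmt-BirchSwinnertonDyer-20509`)

Fifth file of the kernel proof of g5's conjecture (★) `Q_n = q(κ_n)` (crux workfile `Cruxes/RamifiedOffTYZOfFacts/Lines/offtyz_v7_QFormProof.md`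
§4, §6). Abstract arc weights `a` under the reciprocity law `a s t + a t s = y s * y t`, second vector `z`, vertex set `D` with `Σ_D y = 0`,
`Σ_D z = 1`; `N = bigN a D z z z` (symmetric form of Monsky's matrix), `κ_t = treeDet`, `q_x = qwt`; a block `B` is ADMISSIBLE when
`Σ_B y = 0` and `Σ_B z = 1` (`d_B ≡ 5 (mod 8)` for Monsky's data).

* `adjugate_inl_add_inr_eq_sum` — `adj(N)_{(inl s)(inl s)} + adj(N)_{(inr s)(inr s)} = Σ_{B ∋ s adm} q_{z+e_s}(B) · det N(D∖B)` (the `d₀`-formula).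
* `psi_eq_zero`, `psi_eq_zero'` — **Ψ_st = 0**: `Σ_{B ∋ s, B ∌ t, adm} q_{z+e_s}(B) · det N(D∖B) = 0` (point the block of `t` in the complement,
  regroup by `W = B ⊔ Y`; the outer `det N(D∖W)` vanishes unless `W` is admissible-like, and then the inner sum is the key two-block lemma).
* `adjugate_four_eq_sum_admissible` — **(★a) in abstract form**: for `s ≠ t ∈ D`,
  `adj_{ls,ls} + adj_{rs,rs} + adj_{lt,lt} + adj_{rt,rt} = Σ_{B ∋ s,t adm} (κ_s(B) + κ_t(B)) · det N(D∖B)` — together with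
  `adjugate_bigN_self_inr_inr_eq_sum_admissible` (F1b, the abstract (★b)) this is the whole of (★) for the symmetric form; the dictionary to
  Monsky's matrix (`κ = diag adj N`, `κ_t = blockRho_t` on even blocks, `det N(T) = det M_T`) is the next file.
Pure linear algebra over `𝔽₂`; no `sorry`. BSD is not proved by any of this; no class is closed.

References: [cite: Smith2016CongruentDensity, §2.2 case 5(b)]; [cite: Chaiken1982, §2 (all minors matrix tree theorem)];
[cite: Stanley1999EC2, Cor. 5.1.6].
-/

namespace Summit.BirchSwinnertonDyer.PrintCf2.QFormForest

open Matrix Finset Literature.LinearAlgebra.Matrix Literature.Combinatorics.Enumerative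
open Literature.NumberTheory.EllipticCurves.Smith2016

variable {V : Type*} [Fintype V] [LinearOrder V]


/-- **Ψ_st = 0** (note §4/§6): under the reciprocity law on `D` with `Σ_D y = 0`, `Σ_D z = 1`, for `s ≠ t ∈ D`:
`Σ_{B ∋ s, B ∌ t, B admissible} q_{z+e_s}(B) · det N(D∖B) = 0` — point the block of `t` in the complement, regroup by `W = B ⊔ Y`;
the outer factor `det N(D∖W)` vanishes unless `Σ_W y = 0`, `Σ_W z = 1` (parity), and then the inner sum is the key two-block lemma.
[cite: Smith2016CongruentDensity, §2.2 case 5(b)] [cite: Chaiken1982, §2] -/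
theorem psi_eq_zero (a : V → V → ZMod 2) (y z : V → ZMod 2) {D : Finset V}
    (hrec : ∀ i ∈ D, ∀ j ∈ D, i ≠ j → a i j + a j i = y i * y j) (hyD : ∑ i ∈ D, y i = 0) (hzD : ∑ i ∈ D, z i = 1)
    {s t : V} (hs : s ∈ D) (ht : t ∈ D) (hst : s ≠ t) :
    ∑ B₀ ∈ ((D.erase s).erase t).powerset.filter (fun B₀ => ∑ i ∈ insert s B₀, y i = 0 ∧ ∑ i ∈ insert s B₀, z i = 1),
      qwt a (fun i => z i + (Pi.single s (1 : ZMod 2) : V → ZMod 2) i) (insert s B₀) *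
        (bigN a (D.erase s \ B₀) z z z).det = 0 := by
  set D₀ := (D.erase s).erase t with hD₀
  set x : V → ZMod 2 := fun i => z i + (Pi.single s (1 : ZMod 2) : V → ZMod 2) i with hx
  set adm : Finset V → Prop := fun B₀ => ∑ i ∈ insert s B₀, y i = 0 ∧ ∑ i ∈ insert s B₀, z i = 1 with hadm
  have htD₀ : t ∉ D₀ := notMem_erase t _
  have hsD₀ : s ∉ D₀ := fun h => notMem_erase s D (mem_of_mem_erase h)
  have hD₀D : D₀ ⊆ D := (erase_subset t _).trans (erase_subset s D)
  have hcompl : ∀ X₀ ⊆ D₀, D.erase s \ X₀ = insert t (D₀ \ X₀) := by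
    intro X₀ hX₀; ext i
    simp only [mem_sdiff, mem_erase, mem_insert, hD₀]
    constructor
    · rintro ⟨⟨his, hiD⟩, hiX⟩
      by_cases hit : i = t
      · exact Or.inl hit
      · exact Or.inr ⟨⟨hit, his, hiD⟩, hiX⟩
    · rintro (rfl | ⟨⟨hit, his, hiD⟩, hiX⟩)
      · exact ⟨⟨hst.symm, ht⟩, fun h => htD₀ (hX₀ h)⟩
      · exact ⟨⟨his, hiD⟩, hiX⟩
  -- point the block of `t` in the complement and regroup by `W₀ = X₀ ∪ E`
  have hpeel : ∀ X₀ ∈ D₀.powerset.filter adm,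
      qwt a x (insert s X₀) * (bigN a (D.erase s \ X₀) z z z).det =
        ∑ E ∈ (D₀ \ X₀).powerset, (if adm X₀ then 1 else 0) * qwt a x (insert s X₀) *
          (fwt a z z z (insert t E) * setExp (fwt a z z z) ((D₀ \ X₀) \ E)) := by
    intro X₀ hX₀
    rw [mem_filter, mem_powerset] at hX₀
    rw [hcompl X₀ hX₀.1, det_bigN_eq_setExp, setExp_peel _ (mem_insert_self t _),
      erase_insert (fun h => htD₀ ((sdiff_subset) h)), mul_sum, if_pos hX₀.2, one_mul]
  rw [sum_filter]
  have hite : ∀ X₀ ∈ D₀.powerset, (if adm X₀ then qwt a x (insert s X₀) * (bigN a (D.erase s \ X₀) z z z).det else 0) =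
      ∑ E ∈ (D₀ \ X₀).powerset, (if adm X₀ then 1 else 0) * qwt a x (insert s X₀) *
          (fwt a z z z (insert t E) * setExp (fwt a z z z) ((D₀ \ X₀) \ E)) := by
    intro X₀ hX₀
    by_cases h : adm X₀
    · rw [if_pos h, hpeel X₀ (mem_filter.mpr ⟨hX₀, h⟩)]
    · rw [if_neg h]; simp [h]
  rw [sum_congr rfl hite]
  have hregroup := sum_powerset_sum_powerset_sub D₀ (fun X₀ W₀ => (if adm X₀ then 1 else 0) * qwt a x (insert s X₀) *
      (fwt a z z z (insert t (W₀ \ X₀)) * setExp (fwt a z z z) (D₀ \ W₀)))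
  have hrhs : ∀ X₀ ∈ D₀.powerset, ∑ E ∈ (D₀ \ X₀).powerset, (if adm X₀ then 1 else 0) * qwt a x (insert s X₀) *
      (fwt a z z z (insert t E) * setExp (fwt a z z z) ((D₀ \ X₀) \ E)) =
      ∑ E ∈ (D₀ \ X₀).powerset, (if adm X₀ then 1 else 0) * qwt a x (insert s X₀) *
      (fwt a z z z (insert t ((X₀ ∪ E) \ X₀)) * setExp (fwt a z z z) (D₀ \ (X₀ ∪ E))) := by
    intro X₀ hX₀
    refine sum_congr rfl fun E hE => ?_
    rw [mem_powerset] at hE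
    rw [union_sdiff_cancel_left (disjoint_of_subset_right hE disjoint_sdiff), sdiff_sdiff_left, sup_eq_union]
  rw [sum_congr rfl hrhs, ← hregroup]
  refine sum_eq_zero fun W₀ hW₀ => ?_
  rw [mem_powerset] at hW₀
  -- for fixed `W₀`: either the outer determinant vanishes (parity) or the inner sum is the key lemma
  have hsW₀ : s ∉ W₀ := fun h => hsD₀ (hW₀ h)
  have htW₀ : t ∉ W₀ := fun h => htD₀ (hW₀ h)
  have hWD : insert s (insert t W₀) ⊆ D := insert_subset hs (insert_subset ht (hW₀.trans hD₀D))
  have hsplitD : ∀ f : V → ZMod 2, ∑ i ∈ D, f i = ∑ i ∈ insert s (insert t W₀), f i + ∑ i ∈ D₀ \ W₀, f i := by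
    intro f
    have hdisj : Disjoint (insert s (insert t W₀)) (D₀ \ W₀) := by
      rw [disjoint_insert_left, disjoint_insert_left]
      exact ⟨fun h => hsD₀ (sdiff_subset h), fun h => htD₀ (sdiff_subset h), disjoint_sdiff⟩
    rw [← sum_union hdisj]
    congr 1
    ext i
    simp only [mem_union, mem_insert, mem_sdiff, hD₀, mem_erase]
    constructor
    · intro hi
      by_cases his : i = s
      · exact Or.inl (Or.inl his)
      by_cases hit : i = t
      · exact Or.inl (Or.inr (Or.inl hit))
      by_cases hiW : i ∈ W₀
      · exact Or.inl (Or.inr (Or.inr hiW))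
      · exact Or.inr ⟨⟨hit, his, hi⟩, hiW⟩
    · rintro ((rfl | rfl | h) | ⟨⟨_, _, h⟩, _⟩)
      · exact hs
      · exact ht
      · exact hD₀D (hW₀ h)
      · exact h
  have hinner : ∀ X₀ ∈ W₀.powerset, (if adm X₀ then 1 else 0) * qwt a x (insert s X₀) *
      (fwt a z z z (insert t (W₀ \ X₀)) * setExp (fwt a z z z) (D₀ \ W₀)) =
      setExp (fwt a z z z) (D₀ \ W₀) * ((if adm X₀ then 1 else 0) * (qwt a x (insert s X₀) * fwt a z z z (insert t (W₀ \ X₀)))) := by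
    intro X₀ _; ring
  rw [sum_congr rfl hinner, ← mul_sum]
  by_cases hout : (D₀ \ W₀).Nonempty ∧ (∑ i ∈ D₀ \ W₀, y i = 1 ∨ ∑ i ∈ D₀ \ W₀, z i = 1)
  · rw [← det_bigN_eq_setExp, det_bigN_self_eq_zero a y z _ (hrec_mono (sdiff_subset.trans hD₀D) hrec) hout.1 hout.2, zero_mul]
  · -- the complement is even in `y` and `z`: the inner sum is the key lemma
    have h01 : ∀ u : ZMod 2, u ≠ 1 → u = 0 := by decide
    have hyout : ∑ i ∈ D₀ \ W₀, y i = 0 := by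
      by_cases hne : (D₀ \ W₀).Nonempty
      · exact h01 _ (fun h => hout ⟨hne, Or.inl h⟩)
      · rw [not_nonempty_iff_eq_empty.mp hne, sum_empty]
    have hzout : ∑ i ∈ D₀ \ W₀, z i = 0 := by
      by_cases hne : (D₀ \ W₀).Nonempty
      · exact h01 _ (fun h => hout ⟨hne, Or.inr h⟩)
      · rw [not_nonempty_iff_eq_empty.mp hne, sum_empty]
    have hyW : ∑ i ∈ insert s (insert t W₀), y i = 0 := by
      have h := hsplitD y; rw [hyD, hyout, add_zero] at h; exact h.symm
    have hzW : ∑ i ∈ insert s (insert t W₀), z i = 1 := by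
      have h := hsplitD z; rw [hzD, hzout, add_zero] at h; exact h.symm
    have hKL := key_two_block_sum_eq_zero a y z hsW₀ htW₀ hst (hrec_mono hWD hrec) hyW hzW
    rw [sum_filter] at hKL
    have hin : ∑ X₀ ∈ W₀.powerset, (if adm X₀ then 1 else 0) * (qwt a x (insert s X₀) * fwt a z z z (insert t (W₀ \ X₀))) = 0 := by
      refine Eq.trans (sum_congr rfl fun X₀ hX₀ => ?_) hKL
      rw [mem_powerset] at hX₀
      by_cases h : adm X₀
      · have h' : ∑ i ∈ insert s X₀, y i = 0 ∧ ∑ i ∈ insert s X₀, z i = 1 := h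
        rw [if_pos h, one_mul, if_pos h']
        -- `Σ_Y z = 0`, so `fwt a z z z Y = q_z(Y)`
        have hdisj : Disjoint (insert s X₀) (insert t (W₀ \ X₀)) := by
          rw [disjoint_insert_left, disjoint_insert_right, mem_insert]
          exact ⟨fun h' => h'.elim hst (fun h' => hsW₀ (mem_sdiff.mp h').1), fun h' => htW₀ (hX₀ h'), disjoint_sdiff⟩
        have hWsplit : insert s (insert t W₀) = insert s X₀ ∪ insert t (W₀ \ X₀) := by
          ext i; simp only [mem_insert, mem_union, mem_sdiff]; constructor
          · rintro (h' | h' | h')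
            · exact Or.inl (Or.inl h')
            · exact Or.inr (Or.inl h')
            · by_cases hi : i ∈ X₀
              · exact Or.inl (Or.inr hi)
              · exact Or.inr (Or.inr ⟨h', hi⟩)
          · rintro ((h' | h') | h' | ⟨h', _⟩)
            · exact Or.inl h'
            · exact Or.inr (Or.inr (hX₀ h'))
            · exact Or.inr (Or.inl h')
            · exact Or.inr (Or.inr h')
        have hzY : ∑ i ∈ insert t (W₀ \ X₀), z i = 0 := by
          have h2 := hzW
          rw [hWsplit, sum_union hdisj, h'.2] at h2
          have h3 : ∀ u : ZMod 2, 1 + u = 1 → u = 0 := by decide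
          exact h3 _ h2
        rw [fwt, hzY, zero_mul, zero_add]
      · have h' : ¬(∑ i ∈ insert s X₀, y i = 0 ∧ ∑ i ∈ insert s X₀, z i = 1) := h
        rw [if_neg h, if_neg h', zero_mul]
    rw [hin, mul_zero]


omit [Fintype V] in
/-- Re-indexing the blocks containing `t` under an extra predicate: `Σ_{T ⊆ X, t ∈ T, P T} F(T) = Σ_{E ⊆ X∖t, P({t}∪E)} F({t} ∪ E)`.
[cite: Stanley1999EC2, Cor. 5.1.6 (exponential formula; elementary finite form)] -/
theorem sum_powerset_filter_mem_and_eq {R : Type*} [AddCommMonoid R] (F : Finset V → R) {X : Finset V} {t : V} (ht : t ∈ X)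
    (P : Finset V → Prop) [DecidablePred P] :
    ∑ T ∈ X.powerset.filter (fun T => t ∈ T ∧ P T), F T =
      ∑ E ∈ (X.erase t).powerset.filter (fun E => P (insert t E)), F (insert t E) := by
  rw [← filter_filter, sum_filter, sum_powerset_filter_mem_eq _ ht, sum_filter]

/-- `q_{z + e_s}(B) = q_z(B) + κ_s(B)` for `s ∈ B`. [cite: ChebotarevAgaev2002, §3 Thm. 2] -/
theorem qwt_add_single (a : V → V → ZMod 2) (z : V → ZMod 2) {B : Finset V} {s : V} (hs : s ∈ B) :
    qwt a (fun i => z i + (Pi.single s (1 : ZMod 2) : V → ZMod 2) i) B = qwt a z B + treeDet a B s := by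
  rw [qwt_add, qwt_single, if_pos hs]

/-- **`d₀_s = adj(N)_{(inl s)(inl s)} + adj(N)_{(inr s)(inr s)}` as a sum over the admissible blocks containing `s`** (note §4):
`= Σ_{B ∋ s adm} q_{z+e_s}(B) · det N(D∖B)`. [cite: Chaiken1982, §2 (all minors matrix tree theorem)] -/
theorem adjugate_inl_add_inr_eq_sum (a : V → V → ZMod 2) (y z : V → ZMod 2) {D : Finset V}
    (hrec : ∀ i ∈ D, ∀ j ∈ D, i ≠ j → a i j + a j i = y i * y j) (hyD : ∑ i ∈ D, y i = 0) (hzD : ∑ i ∈ D, z i = 1)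
    {s : V} (hs : s ∈ D) :
    (bigN a D z z z).adjugate (Sum.inl s) (Sum.inl s) + (bigN a D z z z).adjugate (Sum.inr s) (Sum.inr s) =
      ∑ B ∈ D.powerset.filter (fun B => s ∈ B ∧ (∑ i ∈ B, y i = 0 ∧ ∑ i ∈ B, z i = 1)),
        qwt a (fun i => z i + (Pi.single s (1 : ZMod 2) : V → ZMod 2) i) B * (bigN a (D \ B) z z z).det := by
  rw [adjugate_bigN_self_inl_inl_eq_sum_admissible a y z hrec hyD hzD hs,
    adjugate_bigN_self_inr_inr_eq_sum_admissible a y z hrec hyD hs, ← sum_add_distrib,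
    sum_powerset_filter_mem_and_eq _ hs (fun B => ∑ i ∈ B, y i = 0 ∧ ∑ i ∈ B, z i = 1)]
  refine sum_congr rfl fun B₀ _ => ?_
  rw [erase_sdiff_eq_sdiff_insert, qwt_add_single a z (mem_insert_self s B₀)]
  ring

/-- **Ψ_st = 0, block form** (note §4): `Σ_{B ⊆ D: s ∈ B, t ∉ B, B adm} q_{z+e_s}(B) · det N(D∖B) = 0`.
[cite: Smith2016CongruentDensity, §2.2 case 5(b)] [cite: Chaiken1982, §2] -/
theorem psi_eq_zero' (a : V → V → ZMod 2) (y z : V → ZMod 2) {D : Finset V}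
    (hrec : ∀ i ∈ D, ∀ j ∈ D, i ≠ j → a i j + a j i = y i * y j) (hyD : ∑ i ∈ D, y i = 0) (hzD : ∑ i ∈ D, z i = 1)
    {s t : V} (hs : s ∈ D) (ht : t ∈ D) (hst : s ≠ t) :
    ∑ B ∈ D.powerset.filter (fun B => s ∈ B ∧ (t ∉ B ∧ (∑ i ∈ B, y i = 0 ∧ ∑ i ∈ B, z i = 1))),
      qwt a (fun i => z i + (Pi.single s (1 : ZMod 2) : V → ZMod 2) i) B * (bigN a (D \ B) z z z).det = 0 := by
  rw [sum_powerset_filter_mem_and_eq _ hs (fun B => t ∉ B ∧ (∑ i ∈ B, y i = 0 ∧ ∑ i ∈ B, z i = 1))]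
  have hset : (D.erase s).powerset.filter (fun E => t ∉ insert s E ∧ (∑ i ∈ insert s E, y i = 0 ∧ ∑ i ∈ insert s E, z i = 1)) =
      ((D.erase s).erase t).powerset.filter (fun B₀ => ∑ i ∈ insert s B₀, y i = 0 ∧ ∑ i ∈ insert s B₀, z i = 1) := by
    ext E
    simp only [mem_filter, mem_powerset, mem_insert, not_or, subset_erase]
    constructor
    · rintro ⟨hE, ⟨_, htE⟩, hadm⟩
      exact ⟨⟨hE, htE⟩, hadm⟩
    · rintro ⟨⟨hE, htE⟩, hadm⟩
      exact ⟨hE, ⟨fun h => hst h.symm, htE⟩, hadm⟩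
  rw [hset]
  refine Eq.trans (sum_congr rfl fun B₀ _ => ?_) (psi_eq_zero a y z hrec hyD hzD hs ht hst)
  rw [erase_sdiff_eq_sdiff_insert]

/-- **(★a), abstract form** (note §4): under the reciprocity law on `D` with `Σ_D y = 0`, `Σ_D z = 1` and `s ≠ t ∈ D`, with
`N = bigN a D z z z`: `adj(N)_{ls,ls} + adj(N)_{rs,rs} + adj(N)_{lt,lt} + adj(N)_{rt,rt} = Σ_{B ∋ s,t adm} (κ_s(B) + κ_t(B)) · det N(D∖B)`
— the `x_s x_t`-coefficient identity of (★) (with `κ = diag adj N` and `κ_t = blockRho_t` on even blocks this is `rhsA = (κA+κB)_s + (κA+κB)_t`).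
[cite: Chaiken1982, §2] [cite: Smith2016CongruentDensity, §2.2] -/
theorem adjugate_four_eq_sum_admissible (a : V → V → ZMod 2) (y z : V → ZMod 2) {D : Finset V}
    (hrec : ∀ i ∈ D, ∀ j ∈ D, i ≠ j → a i j + a j i = y i * y j) (hyD : ∑ i ∈ D, y i = 0) (hzD : ∑ i ∈ D, z i = 1)
    {s t : V} (hs : s ∈ D) (ht : t ∈ D) (hst : s ≠ t) :
    (bigN a D z z z).adjugate (Sum.inl s) (Sum.inl s) + (bigN a D z z z).adjugate (Sum.inr s) (Sum.inr s) +
      ((bigN a D z z z).adjugate (Sum.inl t) (Sum.inl t) + (bigN a D z z z).adjugate (Sum.inr t) (Sum.inr t)) =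
      ∑ B ∈ D.powerset.filter (fun B => s ∈ B ∧ t ∈ B ∧ (∑ i ∈ B, y i = 0 ∧ ∑ i ∈ B, z i = 1)),
        (treeDet a B s + treeDet a B t) * (bigN a (D \ B) z z z).det := by
  rw [adjugate_inl_add_inr_eq_sum a y z hrec hyD hzD hs, adjugate_inl_add_inr_eq_sum a y z hrec hyD hzD ht]
  -- split each sum according to membership of the other vertex; the separated parts are Ψ = 0
  rw [← sum_filter_add_sum_filter_not (D.powerset.filter _) (fun B => t ∈ B), filter_filter, filter_filter,
    ← sum_filter_add_sum_filter_not (D.powerset.filter (fun B => t ∈ B ∧ _)) (fun B => s ∈ B), filter_filter, filter_filter]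
  have hψs : ∑ B ∈ D.powerset.filter (fun B => (s ∈ B ∧ (∑ i ∈ B, y i = 0 ∧ ∑ i ∈ B, z i = 1)) ∧ ¬ t ∈ B),
      qwt a (fun i => z i + (Pi.single s (1 : ZMod 2) : V → ZMod 2) i) B * (bigN a (D \ B) z z z).det = 0 := by
    refine Eq.trans (sum_congr (filter_congr fun B _ => by tauto) fun _ _ => rfl) (psi_eq_zero' a y z hrec hyD hzD hs ht hst)
  have hψt : ∑ B ∈ D.powerset.filter (fun B => (t ∈ B ∧ (∑ i ∈ B, y i = 0 ∧ ∑ i ∈ B, z i = 1)) ∧ ¬ s ∈ B),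
      qwt a (fun i => z i + (Pi.single t (1 : ZMod 2) : V → ZMod 2) i) B * (bigN a (D \ B) z z z).det = 0 := by
    refine Eq.trans (sum_congr (filter_congr fun B _ => by tauto) fun _ _ => rfl) (psi_eq_zero' a y z hrec hyD hzD ht hs hst.symm)
  rw [hψs, hψt, add_zero, add_zero]
  have hft : D.powerset.filter (fun B => (t ∈ B ∧ (∑ i ∈ B, y i = 0 ∧ ∑ i ∈ B, z i = 1)) ∧ s ∈ B) =
      D.powerset.filter (fun B => s ∈ B ∧ t ∈ B ∧ (∑ i ∈ B, y i = 0 ∧ ∑ i ∈ B, z i = 1)) :=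
    filter_congr fun B _ => by tauto
  have hfs : D.powerset.filter (fun B => (s ∈ B ∧ (∑ i ∈ B, y i = 0 ∧ ∑ i ∈ B, z i = 1)) ∧ t ∈ B) =
      D.powerset.filter (fun B => s ∈ B ∧ t ∈ B ∧ (∑ i ∈ B, y i = 0 ∧ ∑ i ∈ B, z i = 1)) :=
    filter_congr fun B _ => by tauto
  rw [hft, hfs, ← sum_add_distrib]
  refine sum_congr rfl fun B hB => ?_
  rw [mem_filter] at hB
  rw [qwt_add_single a z hB.2.1, qwt_add_single a z hB.2.2.1]
  ring_nf
  have h2 : (2 : ZMod 2) = 0 := by decide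
  rw [h2]; ring



end Summit.BirchSwinnertonDyer.PrintCf2.QFormForest
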